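import Literature.MathematicalPhysics.QuantumLattice.AnisotropicHeisenbergGaussianDomination
import Literature.MathematicalPhysics.QuantumLattice.AnisotropicXYInfraredBound
import HarnessLib

/-!
# The ground-state infrared bound for the Heisenberg antiferromagnet with direction-dependent
# couplings — Kennedy–Lieb–Shastry's eqs. (6)–(7) and (12)–(14), direction-resolved

Topic `MathematicalPhysics/QuantumLattice`; companion of `HeisenbergOrderNeelInfrared.lean`
(the isotropic antiferromagnet, whose derivation this file repeats word for word for the model (5))
and of `AnisotropicXYInfraredBound.lean` (the XY version). No named fact is introduced; everything
here is a theorem.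

## What is printed

Kennedy, Lieb and Shastry, J. Stat. Phys. **53** (1988) 1019–1030. P. 1023, eqs. (5)–(7): for
`H = Σ_{⟨xy⟩} J_{xy} 𝐒_x·𝐒_y` with `J = 1, 1, r` in the three lattice directions, "Letting `g^r_q`
denote the Fourier transform of the two-point function for this model, we will show
`0 ≤ g^r_q ≤ f^r_q, q ≠ Q` (6) where `f^r_q = (e^r_0 E^r_q / 12 E^r_{q-Q})^{1/2}`,
`E^r_q = 2 - cos q₁ - cos q₂ + r(1 - cos q₃)` (7)". P. 1026: (12) Cauchy–Schwarz
`g_q² ≤ χ_q · ½⟨[[S_q, H], S_{-q}]⟩`; "For the model (5) … the bound (14)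
[`χ_q ≤ ¼ E_{q-Q}⁻¹`] holds with `E_{q-Q}` replaced by `E^r_{q-Q}`. The double commutator (13)
equals `(2/3)[(2 - cos q₁ - cos q₂)ρ₁ + r(1 - cos q₃)ρ₃]` where `ρ₁` and `ρ₃` are the
expectations of `𝐒_x·𝐒_y` for bonds `{xy}` in the first and third lattice directions"; (14) is
derived from Gaussian domination (18)–(19).

This file proves exactly this DIRECTION-RESOLVED infrared bound — the inequality obtained by
combining (12), (13) and (14), before the energetic simplification `0 ≤ ρ₃ ≤ ρ₁` of p. 1026 that
turns it into the one-parameter form (6)–(7) — for every `d`, every spin `S = n/2`, every coupling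
vector `K > 0` and every even side `L ≥ 4`: with the direction-resolved nearest-neighbour
correlations `εᵢ = |Λ|⁻¹ Σ_z ⟨S¹_z S¹_{z+eᵢ}⟩` (`= -ρᵢ/3` in KLS's notation `e'₀ = 2ρ₁ + rρ₃`,
by spin isotropy),
`0 ≤ ĝ_q` and `ĝ_q² · E^K_{q-Q} ≤ -½ Σᵢ Kᵢ (1 - cos qᵢ) εᵢ` for `q ≠ Q`.
(Isotropic check `K ≡ 1`: `εᵢ = ε = -e₀/3d`, right side `= (e₀/6d) E_q`, i.e. eq. (1).)

## Contents

* observables of `H_K = heisAnisoTorus L n K`: `heisAnisoGroundCorr`, `heisAnisoStructureFactor`,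
  `heisAnisoDirBondCorr`; spin isotropy (I) `heisAnisoGroundCorr_eq_zero_comp` (global quarter
  turns commute with every `𝐒_x·𝐒_y`);
* the staggered field algebra: `heisAnisoStagGradField_cos/sin` (`V_K(cos p·) = 2E^K_p C_{p+Q}`),
  `heisAnisoFieldHamiltonian_smul`;
* the double commutator (13) with direction weights: `lie_lie_heisAnisoTorus`,
  `re_groundStateFunctional_anisoHeis_lie_lie_modes`
  (`Re ω([C_q,[H_K,C_q]]) + Re ω([D_q,[H_K,D_q]]) = -4 Σᵢ Kᵢ(1 - cos qᵢ) Σ_z G¹_K(z, z+eᵢ)`);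
* the assembly `heisAniso_infraredBound_of_groundEnergy_le` ((GD) ⇒ (IR), finite volume) and the
  unconditional `heisAniso_infraredBound_ground` (Gaussian domination being the theorem
  `heisAniso_gaussianDomination_ground` of `AnisotropicHeisenbergGaussianDomination.lean`).

## References

* [KLS1988JSP] T. Kennedy, E. H. Lieb, B. S. Shastry, J. Stat. Phys. 53 (1988) 1019–1030,
  eqs. (5)–(7), (12)–(14), (17)–(19), p. 1026 (read in: E. H. Lieb, *Statistical Mechanics
  (Selecta)*, paper IV.7).
* [DysonLiebSimon1978] F. J. Dyson, E. H. Lieb, B. Simon, J. Stat. Phys. 18 (1978) 335–383, §3.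
-/

noncomputable section

open Matrix Finset Filter Topology
open scoped ComplexOrder
open Literature.MathematicalPhysics.QuantumLattice Literature.MathematicalPhysics.QuantumLattice.SpinOperators
  Literature.Probability.LatticeModels

namespace Literature.MathematicalPhysics.QuantumLattice

variable {d : ℕ}

-- the commutator Lie-ring structure of an associative ring (Mathlib idiom, as in
-- `XYOrderInfraredProofs.lean` / `HeisenbergOrderNeelInfrared.lean`)
attribute [local instance 100] LieRing.ofAssociativeRing

/-! ### Ground-state correlations of the anisotropic antiferromagnet -/

section Observables

/-- The ground-state `α–α` correlation `G^α_K(x,y) = Re ω_K(S^α_x S^α_y)` in the tracial ground-state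
functional of `H_K = heisAnisoTorus L n K` (junk `0` at `L = 0`); KLS's two-point function of the
model (5). [cite: KLS1988JSP, eqs. (5)–(6)] -/
def heisAnisoGroundCorr (α : Fin 3) (L n : ℕ) (K : Fin d → ℝ) (x y : TorusSite d L) : ℝ :=
  if hL : L = 0 then 0
  else
    haveI : NeZero L := ⟨hL⟩
    ((heisAnisoTorus L n K).groundStateFunctional (siteSpin n x α * siteSpin n y α)).re

/-- The ground-state structure factor `ĝ^α_q = |Λ|⁻¹ Σ_{x,y} cos(q·(x-y)) G^α_K(x,y)` of the model
(5) (KLS's `g^r_q`; momenta indexed by the dual torus point `k`, `q = 2πk/L`; junk `0` at `L = 0`).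
[cite: KLS1988JSP, eq. (6)] -/
def heisAnisoStructureFactor (α : Fin 3) (L n : ℕ) (K : Fin d → ℝ) (k : TorusSite d L) : ℝ :=
  if hL : L = 0 then 0
  else
    haveI : NeZero L := ⟨hL⟩
    (∑ x : TorusSite d L, ∑ y : TorusSite d L,
        Real.cos (torusPhase L k (x - y)) * heisAnisoGroundCorr α L n K x y) / (L : ℝ) ^ d

/-- **The direction-resolved nearest-neighbour correlation** `εᵢ^α = |Λ|⁻¹ Σ_x G^α_K(x, x + eᵢ)` —
one third of KLS's `ρ₁`, `ρ₃` ("the expectations of `𝐒_x·𝐒_y` for bonds `{xy}` in the first and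
third lattice directions", p. 1026), per spin component; junk `0` at `L = 0`.
[cite: KLS1988JSP, p. 1026] -/
def heisAnisoDirBondCorr (α : Fin 3) (L n : ℕ) (K : Fin d → ℝ) (i : Fin d) : ℝ :=
  if hL : L = 0 then 0
  else
    haveI : NeZero L := ⟨hL⟩
    (∑ x : TorusSite d L, heisAnisoGroundCorr α L n K x (x + Pi.single i 1)) / (L : ℝ) ^ d

variable (L : ℕ) [NeZero L] (n : ℕ) (K : Fin d → ℝ)

/-- Unfolding on a genuine torus. [cite: KLS1988JSP, eq. (6)] -/
theorem heisAnisoGroundCorr_of_neZero (α : Fin 3) (x y : TorusSite d L) :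
    heisAnisoGroundCorr α L n K x y =
      ((heisAnisoTorus L n K).groundStateFunctional (siteSpin n x α * siteSpin n y α)).re := by
  simp [heisAnisoGroundCorr, NeZero.ne L]

/-- Unfolding on a genuine torus. [cite: KLS1988JSP, eq. (6)] -/
theorem heisAnisoStructureFactor_of_neZero (α : Fin 3) (k : TorusSite d L) :
    heisAnisoStructureFactor α L n K k =
      (∑ x : TorusSite d L, ∑ y : TorusSite d L,
        Real.cos (torusPhase L k (x - y)) * heisAnisoGroundCorr α L n K x y) / (L : ℝ) ^ d := by
  simp [heisAnisoStructureFactor, NeZero.ne L]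

/-- Unfolding on a genuine torus. [cite: KLS1988JSP, p. 1026] -/
theorem heisAnisoDirBondCorr_of_neZero (α : Fin 3) (i : Fin d) :
    heisAnisoDirBondCorr α L n K i =
      (∑ x : TorusSite d L, heisAnisoGroundCorr α L n K x (x + Pi.single i 1)) / (L : ℝ) ^ d := by
  simp [heisAnisoDirBondCorr, NeZero.ne L]

/-- `G^α_K(x,y) = G^α_K(y,x)` (the tracial ground state is Hermitian on products of Hermitian
spins). [cite: KLS1988JSP, eq. (6)] -/
theorem heisAnisoGroundCorr_symm (α : Fin 3) (x y : TorusSite d L) :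
    heisAnisoGroundCorr α L n K x y = heisAnisoGroundCorr α L n K y x := by
  rw [heisAnisoGroundCorr_of_neZero, heisAnisoGroundCorr_of_neZero]
  have h : siteSpin n y α * siteSpin n x α =
      (siteSpin n x α * siteSpin n y α : Op (TorusSite d L) (n + 1))ᴴ := by
    rw [conjTranspose_mul, (siteSpin_isHermitian n x α).eq, (siteSpin_isHermitian n y α).eq]
  rw [h, groundStateFunctional_conjTranspose_re]

/-- `Re ω_K` of the symmetrised bond is the two-point function. [cite: KLS1988JSP, eq. (6)] -/
theorem re_groundStateFunctional_anisoHeis_spinBond (α : Fin 3) (x y : TorusSite d L) :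
    ((heisAnisoTorus L n K).groundStateFunctional (spinBond n α x y)).re =
      heisAnisoGroundCorr α L n K x y := by
  rw [spinBond, LinearMap.map_smul, map_add, smul_eq_mul,
    show (1 / 2 : ℂ) = ((1 / 2 : ℝ) : ℂ) by push_cast; ring, Complex.re_ofReal_mul,
    Complex.add_re, ← heisAnisoGroundCorr_of_neZero, ← heisAnisoGroundCorr_of_neZero,
    heisAnisoGroundCorr_symm L n K α y x]
  ring

/-- **(T)** `|G^α_K(x,y)| ≤ S²` (a normalised positive functional on `S²·1 ∓ S^αS^α ≥ 0`).
[cite: KLS1988JSP, eq. (6)] -/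
theorem heisAnisoGroundCorr_abs_le (α : Fin 3) (x y : TorusSite d L) :
    |heisAnisoGroundCorr α L n K x y| ≤ ((n : ℝ) / 2) ^ 2 := by
  rw [heisAnisoGroundCorr_of_neZero]
  exact abs_re_groundStateFunctional_siteSpin_mul_le (heisAnisoTorus_isHermitian L n K) α x y

/-- The global quarter turn about the `3`-axis commutes with `H_K` (every `𝐒_x·𝐒_y` is invariant).
[cite: KLS1988JSP, p. 1021] -/
theorem quarterTurn_conj_heisAnisoTorus :
    productOp (fun _ : TorusSite d L => diagonal fun k : Fin (n + 1) => (-Complex.I) ^ (k : ℕ)) *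
        heisAnisoTorus L n K *
        (productOp (fun _ : TorusSite d L => diagonal fun k : Fin (n + 1) => (-Complex.I) ^ (k : ℕ)))ᴴ =
      heisAnisoTorus L n K := by
  rw [heisAnisoTorus, heisWeightedHamiltonian, Finset.mul_sum, Finset.sum_mul]
  refine sum_congr rfl fun e _ => ?_
  rw [Matrix.mul_smul, Matrix.smul_mul]
  congr 1
  induction e using Sym2.ind with
  | h x y => rw [spinDotSym_mk, quarterTurn_conj_spinDot]

/-- A quarter turn about the `2`-axis (`V Sᶻ Vᴴ = Sˣ`, `V Sˣ Vᴴ = -Sᶻ`, `V Sʸ Vᴴ = Sʸ`) commutes with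
`H_K`. [cite: KLS1988JSP, p. 1021] -/
theorem yTurn_conj_heisAnisoTorus {V : Matrix (Fin (n + 1)) (Fin (n + 1)) ℂ}
    (hV : V * Vᴴ = 1) (hV' : Vᴴ * V = 1) (hVz : V * SpinOperators.spinZ n * Vᴴ = spinX n)
    (hVx : V * spinX n * Vᴴ = -SpinOperators.spinZ n) (hVy : V * spinY n * Vᴴ = spinY n) :
    productOp (fun _ : TorusSite d L => V) * heisAnisoTorus L n K *
        (productOp (fun _ : TorusSite d L => V))ᴴ = heisAnisoTorus L n K := by
  rw [heisAnisoTorus, heisWeightedHamiltonian, Finset.mul_sum, Finset.sum_mul]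
  refine sum_congr rfl fun e _ => ?_
  rw [Matrix.mul_smul, Matrix.smul_mul]
  congr 1
  induction e using Sym2.ind with
  | h x y => rw [spinDotSym_mk, yTurn_conj_spinDot n hV hV' hVz hVx hVy]

/-- **(I) Isotropy, `1 ↔ 2`**: `⟨S¹_xS¹_y⟩ = ⟨S²_xS²_y⟩` in the tracial ground state of `H_K`
(invariance under the quarter turn about the `3`-axis). [Kennedy–Lieb–Shastry 1988, p. 1021
("the expectation of `S³_xS³_y` is one-third of the expectation of `𝐒_x · 𝐒_y`")]
[cite: KLS1988JSP, p. 1021] -/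
theorem heisAnisoGroundCorr_one_eq_zero (x y : TorusSite d L) :
    heisAnisoGroundCorr 1 L n K x y = heisAnisoGroundCorr 0 L n K x y := by
  rw [heisAnisoGroundCorr_of_neZero, heisAnisoGroundCorr_of_neZero]
  set U : Op (TorusSite d L) (n + 1) :=
    productOp (fun _ : TorusSite d L => diagonal fun k : Fin (n + 1) => (-Complex.I) ^ (k : ℕ))
    with hU
  have hUU : Uᴴ * U = 1 := productOp_conjTranspose_mul fun _ => spinPhase_conjTranspose_mul n
  have hcomm : U * heisAnisoTorus L n K = heisAnisoTorus L n K * U := by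
    have h := quarterTurn_conj_heisAnisoTorus L n K
    have h2 := congrArg (· * U) h
    simp only at h2
    rw [mul_assoc, hUU, mul_one] at h2
    exact h2
  have hinv := groundStateFunctional_conj_of_commute (heisAnisoTorus_isHermitian L n K) hcomm
    hUU (siteSpin n x 1 * siteSpin n y 1)
  rw [productOp_conj_mul (fun _ => spinPhase_conjTranspose_mul n),
    quarterTurn_conj_siteSpin_one, quarterTurn_conj_siteSpin_one] at hinv
  rw [hinv]

/-- **(I) Isotropy, `3 ↔ 1`**: `⟨S³_xS³_y⟩ = ⟨S¹_xS¹_y⟩` in the tracial ground state of `H_K`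
(invariance under the quarter turn about the `2`-axis). [cite: KLS1988JSP, p. 1021] -/
theorem heisAnisoGroundCorr_two_eq_zero (x y : TorusSite d L) :
    heisAnisoGroundCorr 2 L n K x y = heisAnisoGroundCorr 0 L n K x y := by
  rw [heisAnisoGroundCorr_of_neZero, heisAnisoGroundCorr_of_neZero]
  obtain ⟨V, hV, hV', hVz, hVx, hVy⟩ := exists_unitary_conj_spinZ_eq_spinX n
  set U : Op (TorusSite d L) (n + 1) := productOp (fun _ : TorusSite d L => V) with hU
  have hUU : Uᴴ * U = 1 := productOp_conjTranspose_mul fun _ => hV'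
  have hcomm : U * heisAnisoTorus L n K = heisAnisoTorus L n K * U := by
    have h := yTurn_conj_heisAnisoTorus L n K hV hV' hVz hVx hVy
    have h2 := congrArg (· * U) h
    simp only at h2
    rw [mul_assoc, hUU, mul_one] at h2
    exact h2
  have hinv := groundStateFunctional_conj_of_commute (heisAnisoTorus_isHermitian L n K) hcomm
    hUU (siteSpin n x 2 * siteSpin n y 2)
  have hz : U * siteSpin n x 2 * Uᴴ = siteSpin n x 0 := by
    rw [hU, productOp_conj_siteSpin (fun _ => hV), spinVec_two, hVz]
    rfl
  have hz' : U * siteSpin n y 2 * Uᴴ = siteSpin n y 0 := by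
    rw [hU, productOp_conj_siteSpin (fun _ => hV), spinVec_two, hVz]
    rfl
  rw [hU, productOp_conj_mul (fun _ => hV'), ← hU, hz, hz'] at hinv
  rw [hinv]

/-- **(I) Isotropy**: all three components have the same ground-state correlations for `H_K`.
[cite: KLS1988JSP, p. 1021] -/
theorem heisAnisoGroundCorr_eq_zero_comp (α : Fin 3) (x y : TorusSite d L) :
    heisAnisoGroundCorr α L n K x y = heisAnisoGroundCorr 0 L n K x y := by
  fin_cases α
  · rfl
  · exact heisAnisoGroundCorr_one_eq_zero L n K x y
  · exact heisAnisoGroundCorr_two_eq_zero L n K x y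

/-- Isotropy of the direction-resolved bond correlation: `εᵢ^α = εᵢ^1`. [cite: KLS1988JSP, p. 1021] -/
theorem heisAnisoDirBondCorr_eq_zero_comp (α : Fin 3) (i : Fin d) :
    heisAnisoDirBondCorr α L n K i = heisAnisoDirBondCorr 0 L n K i := by
  simp only [heisAnisoDirBondCorr_of_neZero, heisAnisoGroundCorr_eq_zero_comp L n K α]

/-- Isotropy of the structure factor. [cite: KLS1988JSP, p. 1021] -/
theorem heisAnisoStructureFactor_eq_zero_comp (α : Fin 3) (k : TorusSite d L) :
    heisAnisoStructureFactor α L n K k = heisAnisoStructureFactor 0 L n K k := by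
  simp only [heisAnisoStructureFactor_of_neZero, heisAnisoGroundCorr_eq_zero_comp L n K α]

/-- **The energy of `H_K` in the ground state of `H_{K'}` through the direction-resolved bond
correlations** (`L ≥ 3`): `Re ω_{K'}(H_K) = 3 |Λ| Σᵢ Kᵢ εᵢ(K')` — KLS's bookkeeping
"`-e'₀ = -(2ρ₁ + rρ₃)`" per site (p. 1026), with `ρᵢ = -3εᵢ`, written for an arbitrary trial
ground state `ω_{K'}` (as used in the variational comparisons of p. 1026: "we could then lower the
energy … by replacing the ground state"). [cite: KLS1988JSP, p. 1026] -/
theorem re_groundStateFunctional_heisAnisoTorus (hL3 : 3 ≤ L) (K' : Fin d → ℝ) :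
    ((heisAnisoTorus L n K').groundStateFunctional (heisAnisoTorus L n K)).re =
      3 * (L : ℝ) ^ d * ∑ i : Fin d, K i * heisAnisoDirBondCorr 0 L n K' i := by
  have hLd : (0 : ℝ) < (L : ℝ) ^ d := by
    have : (0 : ℝ) < L := by exact_mod_cast Nat.pos_of_ne_zero (NeZero.ne L)
    positivity
  have hdot : ∀ x y : TorusSite d L,
      ((heisAnisoTorus L n K').groundStateFunctional (spinDot n x y)).re =
        3 * heisAnisoGroundCorr 0 L n K' x y := by
    intro x y
    rw [spinDot, map_sum, Complex.re_sum, Fin.sum_univ_three,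
      re_groundStateFunctional_anisoHeis_spinBond, re_groundStateFunctional_anisoHeis_spinBond,
      re_groundStateFunctional_anisoHeis_spinBond, heisAnisoGroundCorr_one_eq_zero,
      heisAnisoGroundCorr_two_eq_zero]
    ring
  rw [heisAnisoTorus_eq_sum L n hL3 K, map_sum, Complex.re_sum]
  simp_rw [map_sum, Complex.re_sum, LinearMap.map_smul, smul_eq_mul, Complex.re_ofReal_mul, hdot]
  rw [sum_comm, mul_sum]
  refine sum_congr rfl fun i _ => ?_
  rw [heisAnisoDirBondCorr_of_neZero, ← mul_sum, ← mul_sum]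
  field_simp

/-- **The ground-state energy through the direction-resolved bond correlations** (`L ≥ 3`):
`E₀(H_K) = Re ω_K(H_K) = 3 |Λ| Σᵢ Kᵢ εᵢ` — KLS's `-e₀^r = -(2ρ₁ + rρ₃)` per site (p. 1026:
"`e'₀ = 2ρ₁ + rρ₃`"), with `ρᵢ = -3εᵢ`. [cite: KLS1988JSP, p. 1026] -/
theorem groundEnergy_heisAnisoTorus_eq (hL3 : 3 ≤ L) :
    (heisAnisoTorus L n K).groundEnergy =
      3 * (L : ℝ) ^ d * ∑ i : Fin d, K i * heisAnisoDirBondCorr 0 L n K i := by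
  have h := congrArg Complex.re (groundStateFunctional_hamiltonian (heisAnisoTorus_isHermitian L n K))
  rw [Complex.ofReal_re] at h
  rw [← h, re_groundStateFunctional_heisAnisoTorus L n K hL3 K]

end Observables

/-! ### The staggered field algebra of the anisotropic antiferromagnet -/

section FieldAlgebra

variable (L : ℕ) [NeZero L] (n : ℕ) (K : Fin d → ℝ)

/-- `V_K(t h) = t V_K(h)`. [cite: KLS1988JSP, eq. (17)] -/
theorem heisAnisoStagGradField_smul (t : ℝ) (h : TorusSite d L → ℝ) :
    heisAnisoStagGradField L n K (t • h) = (t : ℂ) • heisAnisoStagGradField L n K h := by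
  simp only [heisAnisoStagGradField, Pi.smul_apply, smul_eq_mul, smul_sum, smul_smul, ← mul_sub,
    Complex.ofReal_mul]
  refine sum_congr rfl fun x _ => sum_congr rfl fun i _ => ?_
  ring_nf

/-- `V_K(h)` is Hermitian. [cite: KLS1988JSP, eq. (17)] -/
theorem heisAnisoStagGradField_isHermitian (h : TorusSite d L → ℝ) :
    (heisAnisoStagGradField L n K h).IsHermitian := by
  unfold heisAnisoStagGradField
  refine (isSelfAdjoint_sum _ fun x _ => isSelfAdjoint_sum _ fun i _ => ?_).isHermitian
  refine Matrix.IsHermitian.isSelfAdjoint ?_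
  rw [IsHermitian, conjTranspose_smul, Complex.star_def, Complex.conj_ofReal,
    ((stagSiteSpinX_isHermitian L n x).sub (stagSiteSpinX_isHermitian L n _)).eq]

/-- `H_K(t h) = H_K + t(-V_K(h)) + ½t²Q_K(h)` (`L ≥ 3`): the form in which (GD) feeds
`Matrix.groundState_infraredBound_quadratic`. [cite: KLS1988JSP, eqs. (17)–(19)] -/
theorem heisAnisoFieldHamiltonian_smul (hL3 : 3 ≤ L) (t : ℝ) (h : TorusSite d L → ℝ) :
    heisAnisoFieldHamiltonian L n K (t • h) =
      heisAnisoTorus L n K + (t : ℂ) • (-heisAnisoStagGradField L n K h) +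
        ((t ^ 2 * xyAnisoFieldEnergy L K h / 2 : ℝ) : ℂ) • 1 := by
  rw [heisAnisoFieldHamiltonian_eq L n hL3, heisAnisoStagGradField_smul, xyAnisoFieldEnergy_smul,
    smul_neg, sub_eq_add_neg]

/-- Summation by parts, weighted and staggered:
`V_K(h) = Σ_x (Σᵢ Kᵢ(2h_x - h_{x+eᵢ} - h_{x-eᵢ})) S̃¹_x`. [cite: KLS1988JSP, eqs. (17), (19)] -/
theorem heisAnisoStagGradField_eq_sum_laplacian (h : TorusSite d L → ℝ) :
    heisAnisoStagGradField L n K h = ∑ x : TorusSite d L,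
      ((∑ i : Fin d, K i * (2 * h x - h (x + Pi.single i 1) - h (x - Pi.single i 1)) : ℝ) : ℂ) •
        stagSiteSpinX L n x := by
  have hL : heisAnisoStagGradField L n K h =
      (∑ x : TorusSite d L, ∑ i : Fin d,
          ((K i * (h x - h (x + Pi.single i 1)) : ℝ) : ℂ) • stagSiteSpinX L n x) -
        ∑ x : TorusSite d L, ∑ i : Fin d,
          ((K i * (h x - h (x + Pi.single i 1)) : ℝ) : ℂ) • stagSiteSpinX L n (x + Pi.single i 1) := by
    unfold heisAnisoStagGradField
    rw [← sum_sub_distrib]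
    refine sum_congr rfl fun x _ => ?_
    rw [← sum_sub_distrib]
    exact sum_congr rfl fun i _ => smul_sub _ _ _
  have hre : ∀ i : Fin d, ∑ x : TorusSite d L,
      ((K i * (h x - h (x + Pi.single i 1)) : ℝ) : ℂ) • stagSiteSpinX L n (x + Pi.single i 1) =
        ∑ x : TorusSite d L, ((K i * (h (x - Pi.single i 1) - h x) : ℝ) : ℂ) • stagSiteSpinX L n x := by
    intro i
    rw [← (Equiv.subRight (Pi.single i (1 : ZMod L))).sum_comp]
    refine sum_congr rfl fun x _ => ?_
    simp only [Equiv.subRight_apply, sub_add_cancel]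
  have h2 : ∑ x : TorusSite d L, ∑ i : Fin d,
      ((K i * (h x - h (x + Pi.single i 1)) : ℝ) : ℂ) • stagSiteSpinX L n (x + Pi.single i 1) =
        ∑ x : TorusSite d L, ∑ i : Fin d,
          ((K i * (h (x - Pi.single i 1) - h x) : ℝ) : ℂ) • stagSiteSpinX L n x := by
    rw [sum_comm, sum_congr rfl fun i _ => hre i, sum_comm]
  rw [hL, h2, ← sum_sub_distrib]
  refine sum_congr rfl fun x _ => ?_
  rw [← sum_sub_distrib, Complex.ofReal_sum, sum_smul]
  refine sum_congr rfl fun i _ => ?_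
  rw [← sub_smul, ← Complex.ofReal_sub]
  congr 1
  push_cast
  ring

variable (k : ℕ) [NeZero (2 * k)]

/-- **The staggered weighted field of a cosine wave is the shifted cosine mode**:
`V_K(cos(p·)) = 2E^K_p C_{p+Q}` on the even torus. [Kennedy–Lieb–Shastry 1988, after eq. (19)
("changes `S_q` to `S_{q-Q}`") and p. 1026 ("with `E_{q-Q}` replaced by `E^r_{q-Q}`")]
[cite: KLS1988JSP, eqs. (7), (19), p. 1026] -/
theorem heisAnisoStagGradField_cos (p : TorusSite d (2 * k)) :
    heisAnisoStagGradField (2 * k) n K (fun x => Real.cos (torusPhase (2 * k) p x)) =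
      ((2 * NVectorAniso.anisoDispersion K (latticeMomentum (2 * k) p) : ℝ) : ℂ) •
        xyCosMode (2 * k) n (p + neelIndex (2 * k)) := by
  rw [heisAnisoStagGradField_eq_sum_laplacian, xyCosMode, smul_sum]
  refine sum_congr rfl fun x _ => ?_
  rw [anisoLaplacian_cos_torusPhase, stagSiteSpinX, smul_smul, smul_smul, ← Complex.ofReal_mul,
    ← Complex.ofReal_mul, ← neelSign_mul_cos_torusPhase k]
  congr 1
  push_cast
  ring

/-- `V_K(sin(p·)) = 2E^K_p D_{p+Q}` on the even torus. [cite: KLS1988JSP, eqs. (7), (19), p. 1026] -/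
theorem heisAnisoStagGradField_sin (p : TorusSite d (2 * k)) :
    heisAnisoStagGradField (2 * k) n K (fun x => Real.sin (torusPhase (2 * k) p x)) =
      ((2 * NVectorAniso.anisoDispersion K (latticeMomentum (2 * k) p) : ℝ) : ℂ) •
        xySinMode (2 * k) n (p + neelIndex (2 * k)) := by
  rw [heisAnisoStagGradField_eq_sum_laplacian, xySinMode, smul_sum]
  refine sum_congr rfl fun x _ => ?_
  rw [anisoLaplacian_sin_torusPhase, stagSiteSpinX, smul_smul, smul_smul, ← Complex.ofReal_mul,
    ← Complex.ofReal_mul, ← neelSign_mul_sin_torusPhase k]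
  congr 1
  push_cast
  ring

end FieldAlgebra

/-! ### The double commutator `[A, [H_K, A]]` ([KLS1988JSP] eq. (13), p. 1026) -/

section DoubleCommutator

variable (L : ℕ) [NeZero L] (n : ℕ) (K : Fin d → ℝ)

/-- Linearity of the double commutator in the Hamiltonian:
`⁅A,⁅H_K,A⁆⁆ = Σ_xΣᵢ Kᵢ ⁅A,⁅𝐒_x·𝐒_{x+eᵢ},A⁆⁆` (`L ≥ 3`). [cite: KLS1988JSP, eq. (13)] -/
private theorem lie_lie_heisAnisoTorus_eq_sum (hL3 : 3 ≤ L) (A : Op (TorusSite d L) (n + 1)) :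
    ⁅A, ⁅heisAnisoTorus L n K, A⁆⁆ =
      ∑ x : TorusSite d L, ∑ i : Fin d, ((K i : ℝ) : ℂ) • ⁅A, ⁅spinDot n x (x + Pi.single i 1), A⁆⁆ := by
  rw [heisAnisoTorus_eq_sum L n hL3, sum_lie univ _ A, lie_sum univ _ A]
  refine sum_congr rfl fun x _ => ?_
  rw [sum_lie univ _ A, lie_sum univ _ A]
  refine sum_congr rfl fun i _ => ?_
  rw [smul_lie, lie_smul]

/-- **The double commutator of `H_K` with a wave of the first component**: for
`A = Σ_u a_u S¹_u`, `[A, [H_K, A]] = -Σ_x Σᵢ Kᵢ (a_x - a_{x+eᵢ})² (S²_xS²_{x+eᵢ} + S³_xS³_{x+eᵢ})`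
(`L ≥ 3`). [cite: KLS1988JSP, eq. (13), p. 1026] -/
theorem lie_lie_heisAnisoTorus (hL3 : 3 ≤ L) (a : TorusSite d L → ℂ) :
    ⁅(∑ u : TorusSite d L, a u • (siteSpin n u 0 : Op (TorusSite d L) (n + 1))),
      ⁅heisAnisoTorus L n K, ∑ u : TorusSite d L, a u • (siteSpin n u 0 : Op (TorusSite d L) (n + 1))⁆⁆ =
      ∑ x : TorusSite d L, ∑ i : Fin d, ((K i : ℝ) : ℂ) •
        (-((a x - a (x + Pi.single i 1)) ^ 2) •
          (siteSpin n x 1 * siteSpin n (x + Pi.single i 1) 1 +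
            siteSpin n x 2 * siteSpin n (x + Pi.single i 1) 2 : Op (TorusSite d L) (n + 1))) := by
  rw [lie_lie_heisAnisoTorus_eq_sum L n K hL3]
  refine sum_congr rfl fun x _ => sum_congr rfl fun i _ => ?_
  have hxy : x ≠ x + Pi.single i 1 := by
    intro h
    exact single_ne_zero_of_two_le L (by omega) i (left_eq_add.1 h)
  rw [spinDot, Fin.sum_univ_three, spinBond_eq_mul_of_ne hxy 0, spinBond_eq_mul_of_ne hxy 1,
    spinBond_eq_mul_of_ne hxy 2, lie_lie_exchange a hxy]

/-- The ground-state expectation of the double commutator, bond by bond, with isotropy (I):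
`Re ω_K([A,[H_K,A]]) = -2 Σ_xΣᵢ Kᵢ (a_x - a_{x+eᵢ})² G¹_K(x,x+eᵢ)` for a real wave.
[cite: KLS1988JSP, eq. (13), p. 1026] -/
theorem re_groundStateFunctional_anisoHeis_lie_lie (hL3 : 3 ≤ L) (a : TorusSite d L → ℝ) :
    ((heisAnisoTorus L n K).groundStateFunctional
      ⁅(∑ u : TorusSite d L, (a u : ℂ) • (siteSpin n u 0 : Op (TorusSite d L) (n + 1))),
        ⁅heisAnisoTorus L n K,
          ∑ u : TorusSite d L, (a u : ℂ) • (siteSpin n u 0 : Op (TorusSite d L) (n + 1))⁆⁆).re =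
      ∑ x : TorusSite d L, ∑ i : Fin d,
        -2 * K i * (a x - a (x + Pi.single i 1)) ^ 2 * heisAnisoGroundCorr 0 L n K x (x + Pi.single i 1) := by
  rw [lie_lie_heisAnisoTorus L n K hL3, map_sum, Complex.re_sum]
  refine sum_congr rfl fun x _ => ?_
  rw [map_sum, Complex.re_sum]
  refine sum_congr rfl fun i _ => ?_
  have hxy : x ≠ x + Pi.single i 1 := by
    intro h
    exact single_ne_zero_of_two_le L (by omega) i (left_eq_add.1 h)
  rw [LinearMap.map_smul, smul_eq_mul, Complex.re_ofReal_mul, LinearMap.map_smul, smul_eq_mul,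
    show (-(((a x : ℂ) - (a (x + Pi.single i 1) : ℂ)) ^ 2)) =
      ((-((a x - a (x + Pi.single i 1)) ^ 2) : ℝ) : ℂ) by push_cast; ring,
    Complex.re_ofReal_mul, map_add, Complex.add_re, ← spinBond_eq_mul_of_ne hxy 1,
    ← spinBond_eq_mul_of_ne hxy 2, re_groundStateFunctional_anisoHeis_spinBond,
    re_groundStateFunctional_anisoHeis_spinBond, heisAnisoGroundCorr_one_eq_zero,
    heisAnisoGroundCorr_two_eq_zero]
  ring

/-- **The two modes together** (`L ≥ 3`):
`Re ω_K([C_q,[H_K,C_q]]) + Re ω_K([D_q,[H_K,D_q]]) = -4 Σᵢ Kᵢ (1 - cos qᵢ) Σ_z G¹_K(z, z+eᵢ)` —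
KLS's "(2/3)[(2 - cos q₁ - cos q₂)ρ₁ + r(1 - cos q₃)ρ₃]" (p. 1026), per mode and in finite volume.
[cite: KLS1988JSP, eq. (13), p. 1026] -/
theorem re_groundStateFunctional_anisoHeis_lie_lie_modes (hL3 : 3 ≤ L) (q : TorusSite d L) :
    ((heisAnisoTorus L n K).groundStateFunctional
        ⁅xyCosMode L n q, ⁅heisAnisoTorus L n K, xyCosMode L n q⁆⁆).re +
      ((heisAnisoTorus L n K).groundStateFunctional
        ⁅xySinMode L n q, ⁅heisAnisoTorus L n K, xySinMode L n q⁆⁆).re =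
      -4 * ∑ i : Fin d, K i * (1 - Real.cos (latticeMomentum L q i)) *
        ∑ z : TorusSite d L, heisAnisoGroundCorr 0 L n K z (z + Pi.single i 1) := by
  rw [xyCosMode, xySinMode, re_groundStateFunctional_anisoHeis_lie_lie L n K hL3,
    re_groundStateFunctional_anisoHeis_lie_lie L n K hL3, ← sum_add_distrib, mul_sum]
  simp_rw [← sum_add_distrib]
  rw [sum_comm]
  refine sum_congr rfl fun i _ => ?_
  rw [mul_sum, mul_sum]
  refine sum_congr rfl fun z _ => ?_
  have h1 := cos_sq_add_sin_sq_torusPhase L q z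
  have h2 := cos_sq_add_sin_sq_torusPhase L q (z + Pi.single i 1)
  have h3 := cos_torusPhase_sub L q z (z + Pi.single i 1)
  rw [sub_add_cancel_left, cos_torusPhase_neg_single] at h3
  set G := heisAnisoGroundCorr 0 L n K z (z + Pi.single i 1)
  linear_combination (-2 * K i * G) * h1 + (-2 * K i * G) * h2 + (-4 * K i * G) * h3

end DoubleCommutator

/-! ### The structure factor through the two modes -/

section StructureFactor

variable (L : ℕ) [NeZero L] (n : ℕ) (K : Fin d → ℝ)

/-- **The structure factor through the modes**: `|Λ| ĝ¹_K(q) = Re ω_K(C_q²) + Re ω_K(D_q²)`.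
[cite: KLS1988JSP, eq. (6)] -/
theorem heisAnisoStructureFactor_eq_modes (q : TorusSite d L) :
    heisAnisoStructureFactor 0 L n K q * (L : ℝ) ^ d =
      ((heisAnisoTorus L n K).groundStateFunctional (xyCosMode L n q * xyCosMode L n q)).re +
        ((heisAnisoTorus L n K).groundStateFunctional (xySinMode L n q * xySinMode L n q)).re := by
  have hL : (0 : ℝ) < (L : ℝ) ^ d := by
    have : (0 : ℝ) < L := by exact_mod_cast Nat.pos_of_ne_zero (NeZero.ne L)
    positivity
  rw [heisAnisoStructureFactor_of_neZero, div_mul_cancel₀ _ hL.ne', xyCosMode, xySinMode,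
    groundStateFunctional_realWave_mul, groundStateFunctional_realWave_mul, Complex.re_sum,
    Complex.re_sum, ← sum_add_distrib]
  refine sum_congr rfl fun x _ => ?_
  rw [Complex.re_sum, Complex.re_sum, ← sum_add_distrib]
  refine sum_congr rfl fun y _ => ?_
  rw [Complex.re_ofReal_mul, Complex.re_ofReal_mul, heisAnisoGroundCorr_of_neZero, cos_torusPhase_sub]
  ring

end StructureFactor

/-! ### Assembly: (GD) ⇒ the direction-resolved infrared bound -/

section Assembly

variable (L : ℕ) [NeZero L] (n : ℕ) (K : Fin d → ℝ)

/-- **One mode.** If `E₀(H_K) ≤ E₀(H_K(h))` for all fields and `V_K(h) = rW` with `r ≠ 0`, `W`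
Hermitian, then `0 ≤ ½r⁻²Q_K(h) + 2μ Re ω_K(W²) + μ² Re ω_K(W(H_K - E₀)W)` for all real `μ`
(`L ≥ 3`). [cite: KLS1988JSP, eqs. (18)–(19)] -/
theorem heisAniso_modeQuadratic_nonneg (hL3 : 3 ≤ L)
    (hGD : ∀ h : TorusSite d L → ℝ,
      (heisAnisoTorus L n K).groundEnergy ≤ (heisAnisoFieldHamiltonian L n K h).groundEnergy)
    {h : TorusSite d L → ℝ} {W : Op (TorusSite d L) (n + 1)} (hW : W.IsHermitian) {r : ℝ}
    (hVh : heisAnisoStagGradField L n K h = (r : ℂ) • W) (hr : r ≠ 0) (μ : ℝ) :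
    0 ≤ r⁻¹ ^ 2 * xyAnisoFieldEnergy L K h / 2 +
      2 * μ * ((heisAnisoTorus L n K).groundStateFunctional (W * W)).re +
      μ ^ 2 * ((heisAnisoTorus L n K).groundStateFunctional
        (W * (heisAnisoTorus L n K - ((heisAnisoTorus L n K).groundEnergy : ℂ) • 1) * W)).re := by
  have hV : heisAnisoStagGradField L n K (r⁻¹ • h) = W := by
    rw [heisAnisoStagGradField_smul, hVh, smul_smul, ← Complex.ofReal_mul, inv_mul_cancel₀ hr,
      Complex.ofReal_one, one_smul]
  have hQ : xyAnisoFieldEnergy L K (r⁻¹ • h) = r⁻¹ ^ 2 * xyAnisoFieldEnergy L K h :=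
    xyAnisoFieldEnergy_smul L K r⁻¹ h
  have key := Matrix.groundState_infraredBound_quadratic (heisAnisoTorus_isHermitian L n K) hW.neg
    (Q := r⁻¹ ^ 2 * xyAnisoFieldEnergy L K h) (fun t => by
      have ht := hGD (t • (r⁻¹ • h))
      rwa [heisAnisoFieldHamiltonian_smul L n K hL3, hV, hQ] at ht) μ
  simpa only [neg_mul, mul_neg, neg_neg] using key

/-- **(GD) ⇒ the direction-resolved infrared bound, in finite volume, for the anisotropic
antiferromagnet.** On the even torus of side `L = 2k ≥ 4`, every `d`, every spin and every
coupling vector `K`: if `E₀(H_K) ≤ E₀(H_K(h))` for all real staggered fields `h` (KLS eq. (18)),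
then for every momentum `q` with `E^K_{q-Q} > 0`, `0 ≤ ĝ_q` and
`ĝ_q² E^K_{q-Q} ≤ -½ Σᵢ Kᵢ (1 - cos qᵢ) εᵢ` (KLS (12)·(13)·(14) for the model (5):
`g_q² ≤ χ_q · ½⟨[[S_q,H],S_{-q}]⟩`, `χ_q ≤ ¼(E^K_{q-Q})⁻¹`,
`½⟨[[S_q,H],S_{-q}]⟩ = (2/3)Σᵢ Kᵢ(1 - cos qᵢ)ρᵢ`, `ρᵢ = -3εᵢ`). The fields `cos(p·)/2E^K_p`,
`sin(p·)/2E^K_p`, `p = q - Q`, give `V = C_q`, `D_q` and two quadratic inequalities whose sum has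
nonpositive discriminant. [cite: KLS1988JSP, eqs. (5)–(7), (12)–(14), (18)–(19), p. 1026] -/
theorem heisAniso_infraredBound_of_groundEnergy_le (n k : ℕ) (hk : 2 ≤ k) (K : Fin d → ℝ)
    (hGD : haveI : NeZero (2 * k) := ⟨by omega⟩
      ∀ h : TorusSite d (2 * k) → ℝ,
        (heisAnisoTorus (2 * k) n K).groundEnergy ≤
          (heisAnisoFieldHamiltonian (2 * k) n K h).groundEnergy)
    (q : TorusSite d (2 * k))
    (hq : 0 < NVectorAniso.anisoDispersion K (latticeMomentum (2 * k) (q - neelIndex (2 * k)))) :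
    0 ≤ heisAnisoStructureFactor 0 (2 * k) n K q ∧
      heisAnisoStructureFactor 0 (2 * k) n K q ^ 2 *
          NVectorAniso.anisoDispersion K (latticeMomentum (2 * k) (q - neelIndex (2 * k))) ≤
        -(1 / 2 : ℝ) * ∑ i, K i * (1 - Real.cos (latticeMomentum (2 * k) q i)) *
          heisAnisoDirBondCorr 0 (2 * k) n K i := by
  haveI : NeZero (2 * k) := ⟨by omega⟩
  have hL3 : 3 ≤ 2 * k := by omega
  set H : Op (TorusSite d (2 * k)) (n + 1) := heisAnisoTorus (2 * k) n K with hH_def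
  have hH : H.IsHermitian := heisAnisoTorus_isHermitian (2 * k) n K
  set Q : TorusSite d (2 * k) := neelIndex (2 * k) with hQ_def
  set p : TorusSite d (2 * k) := q - Q with hp_def
  have hpQ : p + Q = q := sub_add_cancel q Q
  set E : ℝ := NVectorAniso.anisoDispersion K (latticeMomentum (2 * k) p) with hE_def
  have hE : 0 < E := hq
  set C : Op (TorusSite d (2 * k)) (n + 1) := xyCosMode (2 * k) n q with hC_def
  set D : Op (TorusSite d (2 * k)) (n + 1) := xySinMode (2 * k) n q with hD_def
  set Kop : Op (TorusSite d (2 * k)) (n + 1) := H - (H.groundEnergy : ℂ) • 1 with hK_def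
  set aC : ℝ := (H.groundStateFunctional (C * C)).re with haC_def
  set aD : ℝ := (H.groundStateFunctional (D * D)).re with haD_def
  set bC : ℝ := (H.groundStateFunctional (C * Kop * C)).re with hbC_def
  set bD : ℝ := (H.groundStateFunctional (D * Kop * D)).re with hbD_def
  set Qc : ℝ := xyAnisoFieldEnergy (2 * k) K (fun x => Real.cos (torusPhase (2 * k) p x)) with hQc_def
  set Qs : ℝ := xyAnisoFieldEnergy (2 * k) K (fun x => Real.sin (torusPhase (2 * k) p x)) with hQs_def
  have hLd : 0 < (((2 * k : ℕ) : ℝ)) ^ d := by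
    have : (0 : ℝ) < ((2 * k : ℕ) : ℝ) := by exact_mod_cast (show 0 < 2 * k by omega)
    positivity
  set Sg : ℝ := ∑ i, K i * (1 - Real.cos (latticeMomentum (2 * k) q i)) *
    heisAnisoDirBondCorr 0 (2 * k) n K i with hSg_def
  have h2E : (2 * E) ≠ 0 := by positivity
  -- the staggered fields of the two waves at momentum `p` are the modes at `q = p + Q`
  have hVc : heisAnisoStagGradField (2 * k) n K (fun x => Real.cos (torusPhase (2 * k) p x)) =
      ((2 * E : ℝ) : ℂ) • C := by
    have h := heisAnisoStagGradField_cos n K k p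
    rw [← hQ_def, hpQ] at h
    exact h
  have hVs : heisAnisoStagGradField (2 * k) n K (fun x => Real.sin (torusPhase (2 * k) p x)) =
      ((2 * E : ℝ) : ℂ) • D := by
    have h := heisAnisoStagGradField_sin n K k p
    rw [← hQ_def, hpQ] at h
    exact h
  -- the two quadratic inequalities
  have hquadC : ∀ μ : ℝ, 0 ≤ (2 * E)⁻¹ ^ 2 * Qc / 2 + 2 * μ * aC + μ ^ 2 * bC := fun μ =>
    heisAniso_modeQuadratic_nonneg (2 * k) n K hL3 hGD (xyCosMode_isHermitian (2 * k) n q) hVc h2E μ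
  have hquadS : ∀ μ : ℝ, 0 ≤ (2 * E)⁻¹ ^ 2 * Qs / 2 + 2 * μ * aD + μ ^ 2 * bD := fun μ =>
    heisAniso_modeQuadratic_nonneg (2 * k) n K hL3 hGD (xySinMode_isHermitian (2 * k) n q) hVs h2E μ
  have hQsum : (2 * E)⁻¹ ^ 2 * Qc / 2 + (2 * E)⁻¹ ^ 2 * Qs / 2 =
      (((2 * k : ℕ) : ℝ)) ^ d / (4 * E) := by
    have h := xyAnisoFieldEnergy_cos_add_sin (2 * k) K p
    rw [← hQc_def, ← hQs_def, ← hE_def] at h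
    rw [show (2 * E)⁻¹ ^ 2 * Qc / 2 + (2 * E)⁻¹ ^ 2 * Qs / 2 = (2 * E)⁻¹ ^ 2 * (Qc + Qs) / 2 by
      ring, h]
    field_simp
    ring
  have hdisc : (aC + aD) ^ 2 ≤ (bC + bD) * ((((2 * k : ℕ) : ℝ)) ^ d / (4 * E)) := by
    have hq' : ∀ x : ℝ, 0 ≤ (bC + bD) * (x * x) + 2 * (aC + aD) * x +
        (((2 * k : ℕ) : ℝ)) ^ d / (4 * E) := by
      intro x
      have h1 := hquadC x
      have h2 := hquadS x
      rw [← hQsum]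
      linarith [h1, h2]
    have hd' := discrim_le_zero hq'
    rw [discrim] at hd'
    nlinarith [hd']
  -- `aC + aD = L^d ĝ_q`
  have hA : heisAnisoStructureFactor 0 (2 * k) n K q * (((2 * k : ℕ) : ℝ)) ^ d = aC + aD :=
    heisAnisoStructureFactor_eq_modes (2 * k) n K q
  -- `bC + bD = -2 L^d Σᵢ Kᵢ (1 - cos qᵢ) εᵢ`
  have hB : bC + bD = -2 * (((2 * k : ℕ) : ℝ)) ^ d * Sg := by
    rw [hbC_def, hbD_def, Matrix.re_groundStateFunctional_conj_eq_lie_lie hH C,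
      Matrix.re_groundStateFunctional_conj_eq_lie_lie hH D, ← add_div,
      re_groundStateFunctional_anisoHeis_lie_lie_modes (2 * k) n K hL3 q, hSg_def, mul_sum, mul_sum,
      sum_div]
    refine sum_congr rfl fun i _ => ?_
    rw [heisAnisoDirBondCorr_of_neZero]
    field_simp
    ring
  -- positivity of `ĝ_q`
  have haC : 0 ≤ aC := re_groundStateFunctional_mul_self_nonneg H (xyCosMode_isHermitian (2 * k) n q)
  have haD : 0 ≤ aD := re_groundStateFunctional_mul_self_nonneg H (xySinMode_isHermitian (2 * k) n q)
  have hg0 : 0 ≤ heisAnisoStructureFactor 0 (2 * k) n K q := by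
    have h0 : 0 ≤ heisAnisoStructureFactor 0 (2 * k) n K q * (((2 * k : ℕ) : ℝ)) ^ d := by
      rw [hA]; exact add_nonneg haC haD
    exact nonneg_of_mul_nonneg_left h0 hLd
  refine ⟨hg0, ?_⟩
  rw [hB, ← hA] at hdisc
  have h1 : heisAnisoStructureFactor 0 (2 * k) n K q ^ 2 * E * (4 * ((((2 * k : ℕ) : ℝ)) ^ d) ^ 2) ≤
      (-2 * Sg) * ((((2 * k : ℕ) : ℝ)) ^ d) ^ 2 := by
    have h4E : 0 < 4 * E := by positivity
    have := mul_le_mul_of_nonneg_right hdisc h4E.le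
    calc heisAnisoStructureFactor 0 (2 * k) n K q ^ 2 * E * (4 * ((((2 * k : ℕ) : ℝ)) ^ d) ^ 2)
        = (heisAnisoStructureFactor 0 (2 * k) n K q * (((2 * k : ℕ) : ℝ)) ^ d) ^ 2 * (4 * E) := by
          ring
      _ ≤ -2 * (((2 * k : ℕ) : ℝ)) ^ d * Sg * ((((2 * k : ℕ) : ℝ)) ^ d / (4 * E)) * (4 * E) := this
      _ = (-2 * Sg) * ((((2 * k : ℕ) : ℝ)) ^ d) ^ 2 := by field_simp
  have hL2 : (0 : ℝ) < ((((2 * k : ℕ) : ℝ)) ^ d) ^ 2 := by positivity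
  have h2 : heisAnisoStructureFactor 0 (2 * k) n K q ^ 2 * E * 4 ≤ -2 * Sg := by
    refine le_of_mul_le_mul_right ?_ hL2
    calc heisAnisoStructureFactor 0 (2 * k) n K q ^ 2 * E * 4 * ((((2 * k : ℕ) : ℝ)) ^ d) ^ 2
        = heisAnisoStructureFactor 0 (2 * k) n K q ^ 2 * E *
            (4 * ((((2 * k : ℕ) : ℝ)) ^ d) ^ 2) := by ring
      _ ≤ (-2 * Sg) * ((((2 * k : ℕ) : ℝ)) ^ d) ^ 2 := h1
  show heisAnisoStructureFactor 0 (2 * k) n K q ^ 2 * E ≤ -(1 / 2 : ℝ) * Sg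
  linarith [h2]

/-- **The direction-resolved Kennedy–Lieb–Shastry infrared bound for the antiferromagnet with
direction-dependent couplings (ground state), unconditionally.** For `K > 0` componentwise
(every `d`, every spin `n/2`) on the even torus of side `2k ≥ 4` and every dual momentum `q ≠ Q`:
`0 ≤ ĝ_q` and `ĝ_q² · E^K_{q-Q} ≤ -½ Σᵢ Kᵢ (1 - cos qᵢ) εᵢ` with `E^K_q = ΣᵢKᵢ(1 - cos qᵢ)`
and `εᵢ = |Λ|⁻¹Σ_z⟨S¹_zS¹_{z+eᵢ}⟩` — KLS's (12)·(13)·(14) for the model (5), p. 1026, Gaussian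
domination being the theorem `heisAniso_gaussianDomination_ground`.
[cite: KLS1988JSP, eqs. (5)–(7), (12)–(14), p. 1026] -/
theorem heisAniso_infraredBound_ground (n k : ℕ) (hk : 2 ≤ k) {K : Fin d → ℝ} (hK : ∀ i, 0 < K i)
    (q : TorusSite d (2 * k)) (hq : q ≠ neelIndex (2 * k)) :
    0 ≤ heisAnisoStructureFactor 0 (2 * k) n K q ∧
      heisAnisoStructureFactor 0 (2 * k) n K q ^ 2 *
          NVectorAniso.anisoDispersion K (latticeMomentum (2 * k) (q - neelIndex (2 * k))) ≤
        -(1 / 2 : ℝ) * ∑ i, K i * (1 - Real.cos (latticeMomentum (2 * k) q i)) *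
          heisAnisoDirBondCorr 0 (2 * k) n K i := by
  haveI : NeZero (2 * k) := ⟨by omega⟩
  exact heisAniso_infraredBound_of_groundEnergy_le n k hk K
    (fun h => heisAniso_gaussianDomination_ground (2 * k) n (even_two_mul k) (by omega)
      (fun i => (hK i).le) h) q
    (anisoDispersion_latticeMomentum_pos (2 * k) hK (sub_ne_zero.2 hq))

end Assembly

end Literature.MathematicalPhysics.QuantumLattice
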